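import Mathlib.Analysis.Complex.CauchyIntegral
import Mathlib.Analysis.Complex.MeanValue
import Mathlib.Analysis.Calculus.Deriv.Star
import Mathlib.MeasureTheory.Integral.Prod
import Literature.Analysis.Complex.LengthArea
import HarnessLib

/-!
# The signed area enclosed by the image of a circle, and its radial derivative

Trunk T-STOCH support (complex analysis); the analytic input of the area theorem
(`Literature/Analysis/Complex/AreaTheorem.lean`, Pommerenke, *Boundary Behaviour of Conformal
Maps* (1992), §1.3 eq. (5)–(6)). For `G` holomorphic near the circle `|z| = ρ` put

  `encl G ρ = ½ ∫₀^{2π} Re( conj(G(ρe^{iθ})) · G'(ρe^{iθ}) ρe^{iθ} ) dθ`,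

which for an injectively parametrised curve is the signed area enclosed by
`θ ↦ G(ρe^{iθ})` (`½ ∮ Im(w̄ dw)`). We prove, without any use of Green's theorem or of Fourier
series, the **radial identity**

  `encl G ρ₂ - encl G ρ₁ = ∫_{ρ₁}^{ρ₂} t ∫₀^{2π} ‖G'(te^{iθ})‖² dθ dt`   (`encl_sub_encl`)

for `G` holomorphic on a neighbourhood of the closed annulus `ρ₁ ≤ |z| ≤ ρ₂` (`0 ≤ ρ₁`): the
`t`-derivative of the integrand differs from `2t‖G'‖²` by the `θ`-derivative of the periodic
function `Im(conj(G) e^{iθ} G')`, and Fubini. Consequences: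

* `encl_mono`: `encl G` is monotone in the radius; `encl G 0 = 0`, so `encl G ρ ≥ 0` on discs;
* `pi_mul_sq_mul_norm_deriv_sq_le_encl`: `π ρ² ‖G'(0)‖² ≤ encl G ρ` for `G` holomorphic on a
  neighbourhood of the closed disc (sub-mean-value property of `‖G'‖²`, from the mean value
  property `DiffContOnCl.circleAverage` and Cauchy–Schwarz);
* `volume_image_annulus_eq`: for `G` moreover injective on the open annulus,
  `area G({ρ₁ < |z| < ρ₂}) = encl G ρ₂ - encl G ρ₁` (area formula
  `lintegral_image_eq_lintegral_abs_det_fderiv_mul` with Jacobian `‖G'‖²`, and polar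
  coordinates `Complex.lintegral_comp_polarCoord_symm`).

Mathlib has the area formula, polar coordinates and the mean value property but no statement
about areas enclosed by curves (searched `enclosed`, `Green`, `shoelace`, `area theorem`).

## References

* Ch. Pommerenke, *Boundary Behaviour of Conformal Maps*, Springer (1992), §1.3, eq. (5).
* P. L. Duren, *Univalent Functions*, Springer (1983), §2.1 (Gronwall's area theorem, p. 29).
-/

noncomputable section

open Set Filter Metric Topology MeasureTheory Complex Real intervalIntegral
open scoped ENNReal NNReal ComplexConjugate

namespace Literature.Analysis.Complex

namespace AreaThm

variable {G : ℂ → ℂ} {U : Set ℂ}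

/-! ### The enclosed-area functional -/

/-- The integrand `Re( conj(G(te^{iθ})) G'(te^{iθ}) te^{iθ} )` of `encl`. [folklore] -/
def enclIntegrand (G : ℂ → ℂ) (t θ : ℝ) : ℝ :=
  (conj (G (circleMap 0 t θ)) * (deriv G (circleMap 0 t θ) * circleMap 0 t θ)).re

/-- **The signed area enclosed by the curve `θ ↦ G(ρe^{iθ})`**:
`encl G ρ = ½ ∫₀^{2π} Re(conj(G) G' z) dθ = ½ ∫ Im(w̄ dw)` along `w = G(ρe^{iθ})`
(the shoelace/Green expression for the enclosed area; for `G` holomorphic on the closed disc it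
is the Dirichlet integral `∫∫_{|z|<ρ} ‖G'‖²`, `encl_eq_integral`). [folklore] -/
def encl (G : ℂ → ℂ) (ρ : ℝ) : ℝ :=
  (1 / 2) * ∫ θ in (0 : ℝ)..2 * π, enclIntegrand G ρ θ

/-- `encl G 0 = 0`. [folklore] -/
theorem encl_zero (G : ℂ → ℂ) : encl G 0 = 0 := by
  simp [encl, enclIntegrand, circleMap]

/-! ### Names for the derivative expressions -/

/-- The `t`-derivative of the `encl` integrand (`hasDerivAt_enclIntegrand`), as a function of
`(t, θ)`. [folklore] -/
def dT (G : ℂ → ℂ) (t θ : ℝ) : ℝ :=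
  (star (deriv G (circleMap 0 t θ) * exp (θ * I)) * (deriv G (circleMap 0 t θ) * circleMap 0 t θ) +
    star (G (circleMap 0 t θ)) * (deriv (deriv G) (circleMap 0 t θ) * exp (θ * I) * circleMap 0 t θ +
      deriv G (circleMap 0 t θ) * exp (θ * I))).re

/-- The periodic function `Im(conj(G(te^{iθ})) G'(te^{iθ}) e^{iθ})` whose `θ`-derivative absorbs
the non-`‖G'‖²` part of `dT`. [folklore] -/
def kΘ (G : ℂ → ℂ) (t θ : ℝ) : ℝ :=
  (star (G (circleMap 0 t θ)) * (deriv G (circleMap 0 t θ) * exp (θ * I))).im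

/-- The `θ`-derivative of `kΘ` (`hasDerivAt_kΘ`). [folklore] -/
def dΘ (G : ℂ → ℂ) (t θ : ℝ) : ℝ :=
  (star (deriv G (circleMap 0 t θ) * (circleMap 0 t θ * I)) *
      (deriv G (circleMap 0 t θ) * exp (θ * I)) +
    star (G (circleMap 0 t θ)) * (deriv (deriv G) (circleMap 0 t θ) * (circleMap 0 t θ * I) *
      exp (θ * I) + deriv G (circleMap 0 t θ) * (exp (θ * I) * I))).im

/-! ### Derivatives of the point `te^{iθ}` -/

/-- `t ↦ te^{iθ}` has derivative `e^{iθ}`. [folklore] -/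
theorem hasDerivAt_circleMap_radius (θ t : ℝ) :
    HasDerivAt (fun t : ℝ ↦ circleMap 0 t θ) (exp (θ * I)) t := by
  have h := ((hasDerivAt_id t).ofReal_comp).mul_const (exp (θ * I))
  simp only [id, ofReal_one, one_mul] at h
  simpa [circleMap] using h

/-- `θ ↦ e^{iθ}` has derivative `i e^{iθ}`. [folklore] -/
theorem hasDerivAt_exp_mul_I (θ : ℝ) :
    HasDerivAt (fun θ : ℝ ↦ exp (θ * I)) (exp (θ * I) * I) θ := by
  have h := (((hasDerivAt_id θ).ofReal_comp).mul_const I).cexp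
  simp only [id, ofReal_one, one_mul] at h
  exact h

/-- `‖e^{iθ}‖ = 1`, squared in coordinates. [folklore] -/
theorem exp_mul_I_re_sq_add_im_sq (θ : ℝ) : (exp (θ * I)).re ^ 2 + (exp (θ * I)).im ^ 2 = 1 := by
  rw [Complex.exp_mul_I, ← ofReal_cos, ← ofReal_sin]
  simp only [add_re, ofReal_re, mul_re, ofReal_im, I_re, mul_zero, I_im, mul_one, sub_self,
    add_zero, add_im, mul_im, zero_add]
  nlinarith [Real.sin_sq_add_cos_sq θ, Real.cos_sq_add_sin_sq θ]

/-! ### The key algebraic identity -/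

/-- The `t`-derivative of `Re(conj(G) G' z)` minus the `θ`-derivative of `Im(conj(G) e^{iθ} G')`
is `2t‖G'‖²` (here `a = G`, `b = G'`, `d = G''` at `z = te`, `‖e‖ = 1`). [folklore] -/
theorem re_sub_im_eq (a b d e : ℂ) (t : ℝ) (he : e.re ^ 2 + e.im ^ 2 = 1) :
    (star (b * e) * (b * (t * e)) + star a * (d * e * (t * e) + b * e)).re
      - (star (b * ((t * e) * I)) * (b * e) + star a * (d * ((t * e) * I) * e + b * (e * I))).im
      = 2 * t * ‖b‖ ^ 2 := by
  have hb : ‖b‖ ^ 2 = b.re ^ 2 + b.im ^ 2 := by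
    rw [← Complex.normSq_eq_norm_sq, Complex.normSq_apply]; ring
  rw [hb]
  simp only [Complex.star_def, add_re, mul_re, conj_re, conj_im, mul_im, ofReal_re, ofReal_im,
    I_re, I_im, add_im]
  ring_nf
  linear_combination (2 * t * (b.re ^ 2 + b.im ^ 2)) * he

/-! ### Derivatives of the integrands -/

section Deriv

/-- `G'` is holomorphic where `G` is. [folklore] -/
theorem differentiableOn_deriv (hU : IsOpen U) (hG : DifferentiableOn ℂ G U) :
    DifferentiableOn ℂ (deriv G) U :=
  (hG.analyticOnNhd hU).deriv.differentiableOn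

/-- The `t`-derivative of the integrand `Re(conj(G(te^{iθ})) G'(te^{iθ}) te^{iθ})`. [folklore] -/
theorem hasDerivAt_enclIntegrand (hU : IsOpen U) (hG : DifferentiableOn ℂ G U) {t θ : ℝ}
    (ht : circleMap 0 t θ ∈ U) :
    HasDerivAt (fun t ↦ enclIntegrand G t θ) (dT G t θ) t := by
  have hc : HasDerivAt (fun t : ℝ ↦ circleMap 0 t θ) (exp (θ * I)) t :=
    hasDerivAt_circleMap_radius θ t
  have hGc : HasDerivAt G (deriv G (circleMap 0 t θ)) (circleMap 0 t θ) :=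
    (hG.differentiableAt (hU.mem_nhds ht)).hasDerivAt
  have hG'c : HasDerivAt (deriv G) (deriv (deriv G) (circleMap 0 t θ)) (circleMap 0 t θ) :=
    ((differentiableOn_deriv hU hG).differentiableAt (hU.mem_nhds ht)).hasDerivAt
  have h1 : HasDerivAt (fun t : ℝ ↦ G (circleMap 0 t θ)) (deriv G (circleMap 0 t θ) * exp (θ * I))
      t := hGc.comp t hc
  have h2 : HasDerivAt (deriv G ∘ fun t : ℝ ↦ circleMap 0 t θ)
      (deriv (deriv G) (circleMap 0 t θ) * exp (θ * I)) t := hG'c.comp t hc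
  have h5 := h1.star.mul (h2.mul hc)
  have h6 := Complex.reCLM.hasFDerivAt.comp_hasDerivAt t h5
  have hfun : (fun t ↦ enclIntegrand G t θ) = (Complex.reCLM ∘ fun t : ℝ ↦
      star (G (circleMap 0 t θ)) *
        ((deriv G ∘ fun t : ℝ ↦ circleMap 0 t θ) t * circleMap 0 t θ)) := by
    funext t
    simp [enclIntegrand]
  rw [hfun]
  exact h6.congr_deriv (by simp [dT])

/-- The `θ`-derivative of the periodic function `Im(conj(G(te^{iθ})) G'(te^{iθ}) e^{iθ})`.
[folklore] -/
theorem hasDerivAt_im_conj_mul (hU : IsOpen U) (hG : DifferentiableOn ℂ G U) {t θ : ℝ}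
    (ht : circleMap 0 t θ ∈ U) :
    HasDerivAt (fun θ : ℝ ↦ kΘ G t θ) (dΘ G t θ) θ := by
  have hc : HasDerivAt (circleMap 0 t) (circleMap 0 t θ * I) θ := hasDerivAt_circleMap 0 t θ
  have hGc : HasDerivAt G (deriv G (circleMap 0 t θ)) (circleMap 0 t θ) :=
    (hG.differentiableAt (hU.mem_nhds ht)).hasDerivAt
  have hG'c : HasDerivAt (deriv G) (deriv (deriv G) (circleMap 0 t θ)) (circleMap 0 t θ) :=
    ((differentiableOn_deriv hU hG).differentiableAt (hU.mem_nhds ht)).hasDerivAt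
  have h1 : HasDerivAt (fun θ : ℝ ↦ G (circleMap 0 t θ))
      (deriv G (circleMap 0 t θ) * (circleMap 0 t θ * I)) θ := hGc.comp θ hc
  have h2 : HasDerivAt (deriv G ∘ circleMap 0 t)
      (deriv (deriv G) (circleMap 0 t θ) * (circleMap 0 t θ * I)) θ := hG'c.comp θ hc
  have h5 := h1.star.mul (h2.mul (hasDerivAt_exp_mul_I θ))
  have h6 := Complex.imCLM.hasFDerivAt.comp_hasDerivAt θ h5
  have hfun : (fun θ : ℝ ↦ kΘ G t θ) =
      (Complex.imCLM ∘ fun θ : ℝ ↦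
        star (G (circleMap 0 t θ)) * ((deriv G ∘ circleMap 0 t) θ * exp (θ * I))) := by
    funext θ
    simp [kΘ]
  rw [hfun]
  exact h6.congr_deriv (by simp [dΘ])

/-- **The pointwise identity**: the `t`-derivative of the `encl` integrand equals
`2t‖G'‖²` plus the `θ`-derivative of `Im(conj(G) G' e^{iθ})`. [folklore] -/
theorem dT_eq (G : ℂ → ℂ) (t θ : ℝ) :
    dT G t θ = 2 * t * ‖deriv G (circleMap 0 t θ)‖ ^ 2 + dΘ G t θ := by
  have h := re_sub_im_eq (G (circleMap 0 t θ)) (deriv G (circleMap 0 t θ))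
    (deriv (deriv G) (circleMap 0 t θ)) (exp (θ * I)) t (exp_mul_I_re_sq_add_im_sq θ)
  rw [← circleMap_zero] at h
  unfold dT dΘ
  linarith

end Deriv

/-! ### Continuity of the integrands -/

section Continuity

/-- `(t, θ) ↦ te^{iθ}` is continuous. [folklore] -/
theorem continuous_circleMap_uncurry : Continuous fun p : ℝ × ℝ ↦ circleMap 0 p.1 p.2 := by
  unfold circleMap; fun_prop

/-- Continuity on `{(t, θ) | te^{iθ} ∈ U}` of an expression built from a function continuous
on `U`, evaluated at `te^{iθ}`: a helper for the three integrands below. [folklore] -/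
theorem continuousOn_comp_circleMap {F : ℂ → ℂ} (hF : ContinuousOn F U) :
    ContinuousOn (fun p : ℝ × ℝ ↦ F (circleMap 0 p.1 p.2)) {p | circleMap 0 p.1 p.2 ∈ U} :=
  hF.comp continuous_circleMap_uncurry.continuousOn fun _ hp ↦ hp

variable (hU : IsOpen U) (hG : DifferentiableOn ℂ G U)
include hU hG

/-- `G`, `G'`, `G''` are continuous on `U`. [folklore] -/
theorem continuousOn_derivs :
    ContinuousOn G U ∧ ContinuousOn (deriv G) U ∧ ContinuousOn (deriv (deriv G)) U :=
  ⟨hG.continuousOn, (differentiableOn_deriv hU hG).continuousOn,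
    (differentiableOn_deriv hU (differentiableOn_deriv hU hG)).continuousOn⟩

/-- The `t`-derivative of the `encl` integrand is continuous on `{te^{iθ} ∈ U}`. [folklore] -/
theorem continuousOn_dT :
    ContinuousOn (fun p : ℝ × ℝ ↦ dT G p.1 p.2) {p | circleMap 0 p.1 p.2 ∈ U} := by
  unfold dT
  obtain ⟨h0, h1, h2⟩ := continuousOn_derivs hU hG
  have hG0 := continuousOn_comp_circleMap h0
  have hG1 := continuousOn_comp_circleMap h1
  have hG2 := continuousOn_comp_circleMap h2
  have he : Continuous fun p : ℝ × ℝ ↦ exp (p.2 * I) := by fun_prop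
  have hc := continuous_circleMap_uncurry
  refine Complex.continuous_re.comp_continuousOn ?_
  exact ((hG1.mul he.continuousOn).star.mul (hG1.mul hc.continuousOn)).add
    (hG0.star.mul (((hG2.mul he.continuousOn).mul hc.continuousOn).add (hG1.mul he.continuousOn)))

/-- The `encl` integrand is continuous on `{te^{iθ} ∈ U}`. [folklore] -/
theorem continuousOn_enclIntegrand :
    ContinuousOn (fun p : ℝ × ℝ ↦ enclIntegrand G p.1 p.2) {p | circleMap 0 p.1 p.2 ∈ U} := by
  obtain ⟨h0, h1, -⟩ := continuousOn_derivs hU hG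
  have hG0 := continuousOn_comp_circleMap h0
  have hG1 := continuousOn_comp_circleMap h1
  have hc := continuous_circleMap_uncurry
  unfold enclIntegrand
  refine Complex.continuous_re.comp_continuousOn ?_
  exact (Complex.continuous_conj.comp_continuousOn hG0).mul (hG1.mul hc.continuousOn)

/-- The `θ`-derivative of `Im(conj(G) G' e^{iθ})` is continuous on `{te^{iθ} ∈ U}`. [folklore] -/
theorem continuousOn_dΘ :
    ContinuousOn (fun p : ℝ × ℝ ↦ dΘ G p.1 p.2) {p | circleMap 0 p.1 p.2 ∈ U} := by
  unfold dΘ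
  obtain ⟨h0, h1, h2⟩ := continuousOn_derivs hU hG
  have hG0 := continuousOn_comp_circleMap h0
  have hG1 := continuousOn_comp_circleMap h1
  have hG2 := continuousOn_comp_circleMap h2
  have he : Continuous fun p : ℝ × ℝ ↦ exp (p.2 * I) := by fun_prop
  have heI : Continuous fun p : ℝ × ℝ ↦ exp (p.2 * I) * I := by fun_prop
  have hc := continuous_circleMap_uncurry
  have hcI : Continuous fun p : ℝ × ℝ ↦ circleMap 0 p.1 p.2 * I := hc.mul continuous_const
  refine Complex.continuous_im.comp_continuousOn ?_
  exact ((hG1.mul hcI.continuousOn).star.mul (hG1.mul he.continuousOn)).add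
    (hG0.star.mul (((hG2.mul hcI.continuousOn).mul he.continuousOn).add (hG1.mul heI.continuousOn)))

end Continuity

/-- `kΘ` is `2π`-periodic in `θ`. [folklore] -/
theorem kΘ_two_pi (G : ℂ → ℂ) (t : ℝ) : kΘ G t (2 * π) = kΘ G t 0 := by
  simp only [kΘ]
  rw [(periodic_circleMap 0 t).eq]
  have h : exp (((2 * π : ℝ) : ℂ) * I) = exp (((0 : ℝ) : ℂ) * I) := by
    push_cast
    rw [Complex.exp_two_pi_mul_I, zero_mul, Complex.exp_zero]
  rw [h]

/-! ### The radial identity -/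

section Radial

variable (hU : IsOpen U) (hG : DifferentiableOn ℂ G U)
include hU hG

/-- `∫₀^{2π} dT dθ = 2t ∫₀^{2π} ‖G'‖² dθ`: the `dΘ` part integrates to zero by periodicity.
[folklore] -/
theorem integral_dT_eq {t : ℝ} (ht : ∀ θ, circleMap 0 t θ ∈ U) :
    ∫ θ in (0 : ℝ)..2 * π, dT G t θ =
      2 * t * ∫ θ in (0 : ℝ)..2 * π, ‖deriv G (circleMap 0 t θ)‖ ^ 2 := by
  have hcT : Continuous fun θ ↦ dT G t θ :=
    ((continuousOn_dT hU hG).comp_continuous (f := fun θ : ℝ ↦ (t, θ)) (by fun_prop)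
      fun θ ↦ ht θ).congr fun _ ↦ rfl
  have hcΘ : Continuous fun θ ↦ dΘ G t θ :=
    ((continuousOn_dΘ hU hG).comp_continuous (f := fun θ : ℝ ↦ (t, θ)) (by fun_prop)
      fun θ ↦ ht θ).congr fun _ ↦ rfl
  have hcsq : Continuous fun θ ↦ ‖deriv G (circleMap 0 t θ)‖ ^ 2 :=
    ((((continuousOn_derivs hU hG).2.1.comp_continuous (f := circleMap 0 t)
      (continuous_circleMap 0 t) ht).congr fun _ ↦ rfl).norm).pow 2
  calc ∫ θ in (0 : ℝ)..2 * π, dT G t θ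
      = ∫ θ in (0 : ℝ)..2 * π, (2 * t * ‖deriv G (circleMap 0 t θ)‖ ^ 2 + dΘ G t θ) :=
        intervalIntegral.integral_congr fun θ _ ↦ dT_eq G t θ
    _ = 2 * t * (∫ θ in (0 : ℝ)..2 * π, ‖deriv G (circleMap 0 t θ)‖ ^ 2) +
          ∫ θ in (0 : ℝ)..2 * π, dΘ G t θ := by
        rw [intervalIntegral.integral_add ((hcsq.const_mul _).intervalIntegrable _ _)
          (hcΘ.intervalIntegrable _ _), intervalIntegral.integral_const_mul]
    _ = 2 * t * (∫ θ in (0 : ℝ)..2 * π, ‖deriv G (circleMap 0 t θ)‖ ^ 2) +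
          (kΘ G t (2 * π) - kΘ G t 0) := by
        rw [integral_eq_sub_of_hasDerivAt (fun θ _ ↦ hasDerivAt_im_conj_mul hU hG (ht θ))
          (hcΘ.intervalIntegrable _ _)]
    _ = _ := by rw [kΘ_two_pi, sub_self, add_zero]

/-- **The radial identity** `encl G ρ₂ - encl G ρ₁ = ∫_{ρ₁}^{ρ₂} t ∫₀^{2π} ‖G'(te^{iθ})‖² dθ dt`
for `G` holomorphic on an open set containing the closed annulus `ρ₁ ≤ |z| ≤ ρ₂` (`0 ≤ ρ₁`;
for `ρ₁ = 0` the closed disc). This is the differential form of Green's formula for the area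
swept by the curves `θ ↦ G(te^{iθ})`; it replaces the Fourier-series computation in the usual
proof of the area theorem (Pommerenke (1992), §1.3 (5); Duren (1983), §2.1). [folklore] -/
theorem encl_sub_encl {ρ₁ ρ₂ : ℝ} (h0 : 0 ≤ ρ₁) (h12 : ρ₁ ≤ ρ₂)
    (hsub : ∀ z : ℂ, ρ₁ ≤ ‖z‖ → ‖z‖ ≤ ρ₂ → z ∈ U) :
    encl G ρ₂ - encl G ρ₁ =
      ∫ t in ρ₁..ρ₂, t * ∫ θ in (0 : ℝ)..2 * π, ‖deriv G (circleMap 0 t θ)‖ ^ 2 := by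
  have hmem : ∀ t ∈ Icc ρ₁ ρ₂, ∀ θ : ℝ, circleMap 0 t θ ∈ U := fun t ht θ ↦ by
    refine hsub _ ?_ ?_ <;> rw [norm_circleMap_zero, abs_of_nonneg (h0.trans ht.1)]
    exacts [ht.1, ht.2]
  have hrect : Icc ρ₁ ρ₂ ×ˢ (univ : Set ℝ) ⊆ {p : ℝ × ℝ | circleMap 0 p.1 p.2 ∈ U} :=
    fun p hp ↦ hmem p.1 hp.1 p.2
  have hdTc : ContinuousOn (fun p : ℝ × ℝ ↦ dT G p.1 p.2) (Icc ρ₁ ρ₂ ×ˢ univ) :=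
    (continuousOn_dT hU hG).mono hrect
  have hIc : ContinuousOn (fun p : ℝ × ℝ ↦ enclIntegrand G p.1 p.2) (Icc ρ₁ ρ₂ ×ˢ univ) :=
    (continuousOn_enclIntegrand hU hG).mono hrect
  -- Step A: fundamental theorem of calculus in `t`, for each `θ`
  have hA : ∀ θ : ℝ, enclIntegrand G ρ₂ θ - enclIntegrand G ρ₁ θ = ∫ t in ρ₁..ρ₂, dT G t θ := by
    intro θ
    rw [integral_eq_sub_of_hasDerivAt]
    · intro t ht
      rw [uIcc_of_le h12] at ht
      exact hasDerivAt_enclIntegrand hU hG (hmem t ht θ)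
    · refine ContinuousOn.intervalIntegrable ?_
      rw [uIcc_of_le h12]
      exact (hdTc.comp (f := fun t : ℝ ↦ (t, θ)) (by fun_prop)
        fun t ht ↦ ⟨ht, mem_univ _⟩).congr fun _ _ ↦ rfl
  have hI : ∀ {ρ : ℝ}, ρ ∈ Icc ρ₁ ρ₂ →
      IntervalIntegrable (fun θ ↦ enclIntegrand G ρ θ) volume 0 (2 * π) := fun {ρ} hρ ↦
    ((hIc.comp_continuous (f := fun θ : ℝ ↦ (ρ, θ)) (by fun_prop)
      fun θ ↦ ⟨hρ, mem_univ _⟩).congr fun _ ↦ rfl).intervalIntegrable _ _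
  have hstepA : encl G ρ₂ - encl G ρ₁ =
      (1 / 2) * ∫ θ in (0 : ℝ)..2 * π, ∫ t in ρ₁..ρ₂, dT G t θ := by
    rw [encl, encl, ← mul_sub, ← intervalIntegral.integral_sub (hI ⟨h12, le_rfl⟩)
      (hI ⟨le_rfl, h12⟩)]
    congr 1
    exact intervalIntegral.integral_congr fun θ _ ↦ hA θ
  -- Step B: Fubini
  have hstepB : ∫ θ in (0 : ℝ)..2 * π, ∫ t in ρ₁..ρ₂, dT G t θ =
      ∫ t in ρ₁..ρ₂, ∫ θ in (0 : ℝ)..2 * π, dT G t θ := by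
    have h1 : (fun θ ↦ ∫ t in ρ₁..ρ₂, dT G t θ) = fun θ ↦ ∫ t in Ioc ρ₁ ρ₂, dT G t θ := by
      funext θ; rw [intervalIntegral.integral_of_le h12]
    have h2 : (fun t ↦ ∫ θ in (0 : ℝ)..2 * π, dT G t θ) =
        fun t ↦ ∫ θ in Ioc 0 (2 * π), dT G t θ := by
      funext t; rw [intervalIntegral.integral_of_le (by positivity)]
    rw [intervalIntegral.integral_of_le (by positivity), intervalIntegral.integral_of_le h12, h1, h2]
    refine MeasureTheory.integral_integral_swap ?_
    rw [Measure.prod_restrict, ← Measure.volume_eq_prod]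
    have hc : ContinuousOn (Function.uncurry fun θ t ↦ dT G t θ)
        (Icc 0 (2 * π) ×ˢ Icc ρ₁ ρ₂) := by
      refine (hdTc.comp (f := Prod.swap) continuous_swap.continuousOn ?_).congr fun _ _ ↦ rfl
      rintro ⟨θ, t⟩ ⟨-, ht⟩
      exact ⟨ht, mem_univ _⟩
    exact (hc.integrableOn_compact (isCompact_Icc.prod isCompact_Icc)).mono_set
      (prod_mono Ioc_subset_Icc_self Ioc_subset_Icc_self)
  -- Step C: the angular integral of `dT`
  rw [hstepA, hstepB, ← intervalIntegral.integral_const_mul]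
  refine intervalIntegral.integral_congr fun t ht ↦ ?_
  rw [uIcc_of_le h12] at ht
  show 1 / 2 * ∫ θ in (0 : ℝ)..2 * π, dT G t θ = t * ∫ θ in (0 : ℝ)..2 * π, ‖deriv G (circleMap 0 t θ)‖ ^ 2
  rw [integral_dT_eq hU hG (hmem t ht)]
  ring

/-- **The Dirichlet integral of a disc**: for `G` holomorphic on an open set containing the
closed disc `|z| ≤ ρ`, `encl G ρ = ∫₀^ρ t ∫₀^{2π} ‖G'(te^{iθ})‖² dθ dt (= ∫∫_{|z|<ρ} ‖G'‖²)`.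
[folklore] -/
theorem encl_eq_integral {ρ : ℝ} (hρ : 0 ≤ ρ) (hsub : closedBall (0 : ℂ) ρ ⊆ U) :
    encl G ρ = ∫ t in (0 : ℝ)..ρ, t * ∫ θ in (0 : ℝ)..2 * π, ‖deriv G (circleMap 0 t θ)‖ ^ 2 := by
  have h := encl_sub_encl hU hG le_rfl hρ fun z _ hz ↦ hsub (mem_closedBall_zero_iff.2 hz)
  rwa [encl_zero, sub_zero] at h

omit hU hG in
/-- The angular integral `∫₀^{2π} ‖G'(te^{iθ})‖² dθ` is nonnegative. [folklore] -/
theorem integral_norm_deriv_sq_nonneg (G : ℂ → ℂ) (t : ℝ) :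
    0 ≤ ∫ θ in (0 : ℝ)..2 * π, ‖deriv G (circleMap 0 t θ)‖ ^ 2 :=
  intervalIntegral.integral_nonneg (by positivity) fun θ _ ↦ by positivity

omit hU hG in
/-- **`encl` is monotone in the radius** on an annulus of holomorphy: for
`0 ≤ ρ₁ ≤ ρ₂` with the closed annulus inside `U`, `encl G ρ₁ ≤ encl G ρ₂`. [folklore] -/
theorem encl_mono (hU : IsOpen U) (hG : DifferentiableOn ℂ G U) {ρ₁ ρ₂ : ℝ} (h0 : 0 ≤ ρ₁)
    (h12 : ρ₁ ≤ ρ₂) (hsub : ∀ z : ℂ, ρ₁ ≤ ‖z‖ → ‖z‖ ≤ ρ₂ → z ∈ U) :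
    encl G ρ₁ ≤ encl G ρ₂ := by
  have h := encl_sub_encl hU hG h0 h12 hsub
  have hnn : 0 ≤ ∫ t in ρ₁..ρ₂, t * ∫ θ in (0 : ℝ)..2 * π, ‖deriv G (circleMap 0 t θ)‖ ^ 2 :=
    intervalIntegral.integral_nonneg h12 fun t ht ↦
      mul_nonneg (h0.trans ht.1) (integral_norm_deriv_sq_nonneg G t)
  linarith

/-- `encl G ρ ≥ 0` for `G` holomorphic on a neighbourhood of the closed disc. [folklore] -/
theorem encl_nonneg {ρ : ℝ} (hρ : 0 ≤ ρ) (hsub : closedBall (0 : ℂ) ρ ⊆ U) : 0 ≤ encl G ρ := by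
  have h := encl_mono hU hG le_rfl hρ fun z _ hz ↦ hsub (mem_closedBall_zero_iff.2 hz)
  rwa [encl_zero] at h

/-! ### The sub-mean-value lower bound -/

omit hU hG in
/-- **Cauchy–Schwarz against the mean**: for `F` continuous,
`2π ‖m‖² ≤ ∫₀^{2π} ‖F‖²` whenever `∫₀^{2π} F = 2π m` (expand `0 ≤ ∫ ‖F - m‖²`). [folklore] -/
theorem two_pi_mul_norm_sq_le {F : ℝ → ℂ} (hF : Continuous F) {m : ℂ}
    (hm : ∫ θ in (0 : ℝ)..2 * π, F θ = 2 * π * m) :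
    2 * π * ‖m‖ ^ 2 ≤ ∫ θ in (0 : ℝ)..2 * π, ‖F θ‖ ^ 2 := by
  have h0 : 0 ≤ ∫ θ in (0 : ℝ)..2 * π, ‖F θ - m‖ ^ 2 :=
    intervalIntegral.integral_nonneg (by positivity) fun θ _ ↦ by positivity
  have hexp : ∀ θ, ‖F θ - m‖ ^ 2 = (‖F θ‖ ^ 2 + ‖m‖ ^ 2) - 2 * (F θ * conj m).re := fun θ ↦ by
    rw [← Complex.normSq_eq_norm_sq, ← Complex.normSq_eq_norm_sq, ← Complex.normSq_eq_norm_sq]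
    exact Complex.normSq_sub _ _
  have hc1 : Continuous fun θ ↦ ‖F θ‖ ^ 2 + ‖m‖ ^ 2 := by fun_prop
  have hc2 : Continuous fun θ ↦ 2 * (F θ * conj m).re := by fun_prop
  have hc3 : Continuous fun θ ↦ ‖F θ‖ ^ 2 := by fun_prop
  have hc4 : Continuous fun θ ↦ (F θ * conj m).re := by fun_prop
  have h1 : ∫ θ in (0 : ℝ)..2 * π, ‖F θ - m‖ ^ 2 =
      ((∫ θ in (0 : ℝ)..2 * π, ‖F θ‖ ^ 2) + 2 * π * ‖m‖ ^ 2) -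
        2 * ∫ θ in (0 : ℝ)..2 * π, (F θ * conj m).re := by
    rw [intervalIntegral.integral_congr (g := fun θ ↦ (‖F θ‖ ^ 2 + ‖m‖ ^ 2) -
      2 * (F θ * conj m).re) (fun θ _ ↦ hexp θ),
      intervalIntegral.integral_sub (hc1.intervalIntegrable _ _) (hc2.intervalIntegrable _ _),
      intervalIntegral.integral_add (hc3.intervalIntegrable _ _)
        (continuous_const.intervalIntegrable _ _),
      intervalIntegral.integral_const, intervalIntegral.integral_const_mul]
    simp only [smul_eq_mul, sub_zero]
  have h2 : ∫ θ in (0 : ℝ)..2 * π, (F θ * conj m).re = 2 * π * ‖m‖ ^ 2 := by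
    have hi : IntervalIntegrable (fun θ ↦ F θ * conj m) volume 0 (2 * π) :=
      (hF.mul continuous_const).intervalIntegrable _ _
    have := intervalIntegral_re hi
    simp only [RCLike.re_to_complex] at this
    rw [this, intervalIntegral.integral_mul_const, hm, mul_assoc, Complex.mul_conj,
      Complex.normSq_eq_norm_sq]
    norm_cast
  rw [h1, h2] at h0
  linarith

/-- **Sub-mean-value property of `‖G'‖²` on circles**: for `G` holomorphic on an open set
containing the closed disc `|z| ≤ t`, `2π ‖G'(0)‖² ≤ ∫₀^{2π} ‖G'(te^{iθ})‖² dθ` (mean value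
property `G'(0) = ⨍ G'(te^{iθ}) dθ`, `DiffContOnCl.circleAverage`, and Cauchy–Schwarz).
[folklore] -/
theorem two_pi_mul_norm_deriv_sq_le {t : ℝ} (ht : 0 ≤ t) (hsub : closedBall (0 : ℂ) t ⊆ U) :
    2 * π * ‖deriv G 0‖ ^ 2 ≤ ∫ θ in (0 : ℝ)..2 * π, ‖deriv G (circleMap 0 t θ)‖ ^ 2 := by
  have hd : DifferentiableOn ℂ (deriv G) U := differentiableOn_deriv hU hG
  have hdc : DiffContOnCl ℂ (deriv G) (ball 0 |t|) := by
    refine DifferentiableOn.diffContOnCl (hd.mono (closure_ball_subset_closedBall.trans ?_))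
    rwa [abs_of_nonneg ht]
  have hmv := hdc.circleAverage
  rw [circleAverage_def] at hmv
  have hmem : ∀ θ, circleMap 0 t θ ∈ U := fun θ ↦ hsub (circleMap_mem_closedBall 0 ht θ)
  have hF : Continuous fun θ ↦ deriv G (circleMap 0 t θ) :=
    (hd.continuousOn.comp_continuous (f := circleMap 0 t) (continuous_circleMap 0 t) hmem).congr
      fun _ ↦ rfl
  refine two_pi_mul_norm_sq_le hF ?_
  have h2π : (2 * π : ℝ) ≠ 0 := by positivity
  have h : ∫ θ in (0 : ℝ)..2 * π, deriv G (circleMap 0 t θ) = (2 * π : ℝ) • deriv G 0 := by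
    rw [← hmv, smul_smul, mul_inv_cancel₀ h2π, one_smul]
  rw [h, Complex.real_smul]
  push_cast
  ring

/-- **`π ρ² ‖G'(0)‖² ≤ encl G ρ`** for `G` holomorphic on an open set containing the closed disc
`|z| ≤ ρ`: by `encl_eq_integral` and the sub-mean-value property of `‖G'‖²`. (Equality for
`G` affine; with the area theorem this is `Σ n |aₙ|² ρ^{2n} ≥ |a₁|² ρ²`.) [folklore] -/
theorem pi_mul_sq_mul_norm_deriv_sq_le_encl {ρ : ℝ} (hρ : 0 ≤ ρ)
    (hsub : closedBall (0 : ℂ) ρ ⊆ U) : π * ρ ^ 2 * ‖deriv G 0‖ ^ 2 ≤ encl G ρ := by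
  rw [encl_eq_integral hU hG hρ hsub]
  -- continuity of the angular integral in `t ∈ [0, ρ]` (freeze `t` into `[0, ρ]` by `projIcc`)
  set g : ℝ × ℝ → ℝ := fun p ↦ ‖deriv G (circleMap 0 (projIcc 0 ρ hρ p.1) p.2)‖ ^ 2 with hg
  have hgc : Continuous g := by
    have hmem : ∀ p : ℝ × ℝ, circleMap 0 ((projIcc 0 ρ hρ p.1 : ℝ)) p.2 ∈ U := fun p ↦
      hsub (mem_closedBall_zero_iff.2 (by
        rw [norm_circleMap_zero, abs_of_nonneg (projIcc 0 ρ hρ p.1).2.1]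
        exact (projIcc 0 ρ hρ p.1).2.2))
    have h1 : Continuous fun p : ℝ × ℝ ↦ circleMap 0 ((projIcc 0 ρ hρ p.1 : ℝ)) p.2 := by
      unfold circleMap; fun_prop
    exact (((differentiableOn_deriv hU hG).continuousOn.comp_continuous h1 hmem).norm).pow 2
  have hcontI : Continuous fun t ↦ ∫ θ in (0 : ℝ)..2 * π, g (t, θ) :=
    intervalIntegral.continuous_parametric_intervalIntegral_of_continuous' (f := fun t θ ↦ g (t, θ))
      hgc 0 (2 * π)
  have hcont : ContinuousOn
      (fun t ↦ t * ∫ θ in (0 : ℝ)..2 * π, ‖deriv G (circleMap 0 t θ)‖ ^ 2) (Icc 0 ρ) := by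
    refine (continuous_id.mul hcontI).continuousOn.congr fun t ht ↦ ?_
    show t * _ = t * _
    simp only [hg]
    rw [projIcc_of_mem hρ ht]
  calc π * ρ ^ 2 * ‖deriv G 0‖ ^ 2 = ∫ t in (0 : ℝ)..ρ, t * (2 * π * ‖deriv G 0‖ ^ 2) := by
        rw [intervalIntegral.integral_mul_const, integral_id]; ring
    _ ≤ ∫ t in (0 : ℝ)..ρ, t * ∫ θ in (0 : ℝ)..2 * π, ‖deriv G (circleMap 0 t θ)‖ ^ 2 := by
        refine intervalIntegral.integral_mono_on hρ
          ((continuous_id.mul continuous_const).intervalIntegrable _ _)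
          (hcont.intervalIntegrable_of_Icc hρ) fun t ht ↦ ?_
        exact mul_le_mul_of_nonneg_left (two_pi_mul_norm_deriv_sq_le hU hG ht.1
          ((closedBall_subset_closedBall ht.2).trans hsub)) ht.1

/-! ### The area of the image of an annulus -/

/-- Continuity in the radius of the angular integral `∫₀^{2π} ‖G'(te^{iθ})‖² dθ` on an interval
`[ρ₁, ρ₂]` whose closed annulus lies in `U`. [folklore] -/
theorem continuousOn_integral_norm_deriv_sq {ρ₁ ρ₂ : ℝ} (h0 : 0 ≤ ρ₁) (h12 : ρ₁ ≤ ρ₂)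
    (hsub : ∀ z : ℂ, ρ₁ ≤ ‖z‖ → ‖z‖ ≤ ρ₂ → z ∈ U) :
    ContinuousOn (fun t ↦ ∫ θ in (0 : ℝ)..2 * π, ‖deriv G (circleMap 0 t θ)‖ ^ 2) (Icc ρ₁ ρ₂) := by
  set g : ℝ × ℝ → ℝ := fun p ↦ ‖deriv G (circleMap 0 (projIcc ρ₁ ρ₂ h12 p.1) p.2)‖ ^ 2 with hg
  have hgc : Continuous g := by
    have hmem : ∀ p : ℝ × ℝ, circleMap 0 ((projIcc ρ₁ ρ₂ h12 p.1 : ℝ)) p.2 ∈ U := fun p ↦ by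
      refine hsub _ ?_ ?_ <;>
        rw [norm_circleMap_zero, abs_of_nonneg (h0.trans (projIcc ρ₁ ρ₂ h12 p.1).2.1)]
      exacts [(projIcc ρ₁ ρ₂ h12 p.1).2.1, (projIcc ρ₁ ρ₂ h12 p.1).2.2]
    have h1 : Continuous fun p : ℝ × ℝ ↦ circleMap 0 ((projIcc ρ₁ ρ₂ h12 p.1 : ℝ)) p.2 := by
      unfold circleMap; fun_prop
    exact (((differentiableOn_deriv hU hG).continuousOn.comp_continuous h1 hmem).norm).pow 2
  have hcontI : Continuous fun t ↦ ∫ θ in (0 : ℝ)..2 * π, g (t, θ) :=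
    intervalIntegral.continuous_parametric_intervalIntegral_of_continuous'
      (f := fun t θ ↦ g (t, θ)) hgc 0 (2 * π)
  refine hcontI.continuousOn.congr fun t ht ↦ ?_
  simp only [hg]
  rw [projIcc_of_mem h12 ht]

omit hU hG in
/-- The angular integral over `(-π, π)` (as a Lebesgue integral of `ofReal`) equals `ofReal` of the
interval integral over `[0, 2π]`, by periodicity. [folklore] -/
theorem lintegral_Ioo_eq_ofReal {F : ℝ → ℝ} (hF : Continuous F) (hper : Function.Periodic F (2 * π))
    (hnn : ∀ θ, 0 ≤ F θ) :
    ∫⁻ θ in Ioo (-π) π, ENNReal.ofReal (F θ) = ENNReal.ofReal (∫ θ in (0 : ℝ)..2 * π, F θ) := by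
  rw [← ofReal_integral_eq_lintegral_ofReal (hF.integrableOn_Icc.mono_set Ioo_subset_Icc_self)
    (Eventually.of_forall fun θ ↦ hnn θ)]
  congr 1
  rw [← integral_Ioc_eq_integral_Ioo, ← intervalIntegral.integral_of_le (by linarith [pi_pos])]
  have h := hper.intervalIntegral_add_eq (-π) 0
  rw [zero_add, show -π + 2 * π = π by ring] at h
  exact h

/-- **Area of the image of an annulus under an injective holomorphic map**:
`area G({ρ₁ < |z| < ρ₂}) = encl G ρ₂ - encl G ρ₁` (`= ∫∫ ‖G'‖²` by the area formula and polar
coordinates, then `encl_sub_encl`). [folklore] -/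
theorem volume_image_annulus_eq {ρ₁ ρ₂ : ℝ} (h0 : 0 ≤ ρ₁) (h12 : ρ₁ ≤ ρ₂)
    (hsub : ∀ z : ℂ, ρ₁ ≤ ‖z‖ → ‖z‖ ≤ ρ₂ → z ∈ U)
    (hinj : InjOn G {z : ℂ | ρ₁ < ‖z‖ ∧ ‖z‖ < ρ₂}) :
    volume (G '' {z : ℂ | ρ₁ < ‖z‖ ∧ ‖z‖ < ρ₂}) = ENNReal.ofReal (encl G ρ₂ - encl G ρ₁) := by
  set A : Set ℂ := {z : ℂ | ρ₁ < ‖z‖ ∧ ‖z‖ < ρ₂} with hA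
  have hAo : IsOpen A := by
    have : A = (fun z : ℂ ↦ ‖z‖) ⁻¹' Ioo ρ₁ ρ₂ := by ext z; simp [hA]
    rw [this]; exact isOpen_Ioo.preimage continuous_norm
  have hAm : MeasurableSet A := hAo.measurableSet
  have hAU : A ⊆ U := fun z hz ↦ hsub z hz.1.le hz.2.le
  -- the area formula
  have hd : ∀ w ∈ A, HasFDerivWithinAt G
      ((ContinuousLinearMap.smulRight (1 : ℂ →L[ℂ] ℂ) (deriv G w)).restrictScalars ℝ) A w :=
    fun w hw ↦ ((hG.differentiableAt (hU.mem_nhds (hAU hw))).hasDerivAt.hasFDerivAt.restrictScalars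
      ℝ).hasFDerivWithinAt
  have h1 : volume (G '' A) = ∫⁻ w in A, ENNReal.ofReal (‖deriv G w‖ ^ 2) := by
    have := lintegral_image_eq_lintegral_abs_det_fderiv_mul volume hAm hd hinj (fun _ ↦ 1)
    simp only [mul_one, lintegral_one, Measure.restrict_apply_univ] at this
    rw [this]
    refine setLIntegral_congr_fun hAm fun w _ ↦ ?_
    rw [LengthArea.det_restrictScalars_smulRight, abs_of_nonneg (by positivity)]
  -- polar coordinates
  set F : ℂ → ℝ≥0∞ := A.indicator fun w ↦ ENNReal.ofReal (‖deriv G w‖ ^ 2) with hF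
  have hFm : Measurable F :=
    (((measurable_deriv G).norm.pow_const 2).ennreal_ofReal).indicator hAm
  have h2 : ∫⁻ w in A, ENNReal.ofReal (‖deriv G w‖ ^ 2) =
      ∫⁻ r in Ioi (0 : ℝ), ∫⁻ θ in Ioo (-π) π,
        ENNReal.ofReal r * F (r * exp (θ * I)) := by
    rw [← lintegral_indicator hAm, ← hF, ← Complex.lintegral_comp_polarCoord_symm F]
    simp only [LengthArea.polarCoord_symm_eq, smul_eq_mul]
    refine LengthArea.lintegral_polarCoord_target_eq ?_
    exact measurable_fst.ennreal_ofReal.mul (hFm.comp (by fun_prop))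
  -- the inner integrals
  have hinner : ∀ r ∈ Ioi (0 : ℝ), ∫⁻ θ in Ioo (-π) π, ENNReal.ofReal r * F (r * exp (θ * I)) =
      (Ioo ρ₁ ρ₂).indicator (fun r ↦ ENNReal.ofReal r *
        ENNReal.ofReal (∫ θ in (0 : ℝ)..2 * π, ‖deriv G (circleMap 0 r θ)‖ ^ 2)) r := by
    intro r hr
    have hr0 : 0 < r := hr
    have hnorm : ∀ θ : ℝ, ‖(r : ℂ) * exp (θ * I)‖ = r := fun θ ↦ by
      rw [← circleMap_zero, norm_circleMap_zero, abs_of_pos hr0]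
    by_cases hrA : r ∈ Ioo ρ₁ ρ₂
    · rw [indicator_of_mem hrA]
      have hmemA : ∀ θ : ℝ, (r : ℂ) * exp (θ * I) ∈ A := fun θ ↦ by
        simp only [hA, mem_setOf_eq, hnorm]; exact hrA
      have hF' : ∀ θ : ℝ, F (r * exp (θ * I)) = ENNReal.ofReal (‖deriv G (circleMap 0 r θ)‖ ^ 2) :=
        fun θ ↦ by rw [hF, indicator_of_mem (hmemA θ), circleMap_zero]
      simp_rw [hF']
      rw [lintegral_const_mul' _ _ ENNReal.ofReal_ne_top]
      congr 1
      have hmemU : ∀ θ, circleMap 0 r θ ∈ U := fun θ ↦ hAU (by rw [circleMap_zero]; exact hmemA θ)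
      have hc : Continuous fun θ ↦ ‖deriv G (circleMap 0 r θ)‖ ^ 2 :=
        ((((differentiableOn_deriv hU hG).continuousOn.comp_continuous (f := circleMap 0 r)
          (continuous_circleMap 0 r) hmemU).congr fun _ ↦ rfl).norm).pow 2
      refine lintegral_Ioo_eq_ofReal hc (fun θ ↦ ?_) fun θ ↦ by positivity
      simp only [(periodic_circleMap 0 r) θ]
    · rw [indicator_of_notMem hrA]
      have hF' : ∀ θ : ℝ, F (r * exp (θ * I)) = 0 := fun θ ↦ by
        rw [hF, indicator_of_notMem]
        simp only [hA, mem_setOf_eq, hnorm]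
        exact hrA
      simp_rw [hF', mul_zero, lintegral_zero]
  have h3 : ∫⁻ r in Ioi (0 : ℝ), ∫⁻ θ in Ioo (-π) π, ENNReal.ofReal r * F (r * exp (θ * I)) =
      ∫⁻ r in Ioo ρ₁ ρ₂, ENNReal.ofReal (r * ∫ θ in (0 : ℝ)..2 * π, ‖deriv G (circleMap 0 r θ)‖ ^ 2) := by
    rw [setLIntegral_congr_fun measurableSet_Ioi hinner, ← lintegral_indicator measurableSet_Ioo,
      ← lintegral_indicator measurableSet_Ioi]
    congr 1
    funext r
    by_cases hr : r ∈ Ioo ρ₁ ρ₂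
    · have hr' : r ∈ Ioi (0 : ℝ) := h0.trans_lt hr.1
      rw [indicator_of_mem hr', indicator_of_mem hr, indicator_of_mem hr,
        ENNReal.ofReal_mul (h0.trans hr.1.le)]
    · rw [indicator_of_notMem hr]
      by_cases hr' : r ∈ Ioi (0 : ℝ)
      · rw [indicator_of_mem hr', indicator_of_notMem hr]
      · rw [indicator_of_notMem hr']
  -- the outer integral
  have hcont : ContinuousOn
      (fun t ↦ t * ∫ θ in (0 : ℝ)..2 * π, ‖deriv G (circleMap 0 t θ)‖ ^ 2) (Icc ρ₁ ρ₂) :=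
    continuousOn_id.mul (continuousOn_integral_norm_deriv_sq hU hG h0 h12 hsub)
  have h4 : ∫⁻ r in Ioo ρ₁ ρ₂, ENNReal.ofReal (r * ∫ θ in (0 : ℝ)..2 * π,
      ‖deriv G (circleMap 0 r θ)‖ ^ 2) =
      ENNReal.ofReal (∫ r in ρ₁..ρ₂, r * ∫ θ in (0 : ℝ)..2 * π, ‖deriv G (circleMap 0 r θ)‖ ^ 2) := by
    rw [← ofReal_integral_eq_lintegral_ofReal
      ((hcont.integrableOn_compact isCompact_Icc).mono_set Ioo_subset_Icc_self)]
    · rw [← integral_Ioc_eq_integral_Ioo, ← intervalIntegral.integral_of_le h12]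
    · refine (ae_restrict_iff' measurableSet_Ioo).2 (Eventually.of_forall fun r hr ↦ ?_)
      exact mul_nonneg (h0.trans hr.1.le) (integral_norm_deriv_sq_nonneg G r)
  rw [h1, h2, h3, h4, encl_sub_encl hU hG h0 h12 hsub]

end Radial

end AreaThm

end Literature.Analysis.Complex
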